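import Literature.NumberTheory.LFunctions.MauduitRivatTypeIISmoothing
import Literature.NumberTheory.LFunctions.MauduitRivatFourierL2
import HarnessLib

/-!
# Mauduit–Rivat's type-II estimate for unitary matrices, step 4: Fourier analysis of `S₄` (§6.3 of Mauduit–Rivat 2015; proved)

Everything in this file is PROVED (plus plain definitions). It carries out, for unitary-matrix
weights and the discrete Fejér smoothing of `MauduitRivatTypeIISmoothing.lean`, the computation of
C. Mauduit, J. Rivat, J. Eur. Math. Soc. 17 (2015), §6.3 ("Fourier analysis of `S₄(r,s)`",
p. 2617): the smoothed indicators are expanded into additive characters, and the sums over the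
prescribed middle digits `u₀, u₁` are evaluated in terms of the discrete Fourier transform
`ĝ = dftR k^{μ₂−μ₀} (U ∘ g)` ((71)), the order of the matrices being kept as in C. Müllner,
Duke Math. J. 166 (2017), §5.4.2 (the display defining `S₄(r,s)` there).

* `ahat K L H h` — the Fourier coefficients of the smoothed block indicator:
  `A_u(x) = ∑_{|h|<H} â(h) e(−hu/K') e(hx/K)` (`smoothInd_eq_sum_ahat`), with
  `‖â(h)‖ ≤ K⁻¹ min(L, 1/(2‖h/K‖))` (`norm_ahat_le`) — the shape (15) of Mauduit–Rivat's `a_h(α,H)`,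
  `α = L/K = k^{μ₀−μ₂}`;
* `sum_twist_gmat_conj_mul`, `sum_twist_gmat_conj_mul'` — the `u`-sums
  `∑_{u<K'} e(−h₀u/K') G(u+c)ᴴG(u) = K' ∑_{h₂<K'} e(−ch₂/K') ĝ(h₂)ᴴ ĝ(h₀+h₂)` and
  `∑_{u<K'} e(−h₁u/K') G(u)ᴴG(u+c) = K' ∑_{h₃<K'} e(c(h₁+h₃)/K') ĝ(h₃)ᴴ ĝ(h₁+h₃)` (`G = U ∘ g`,
  `K' = k^{μ₂−μ₀}`; orthogonality of characters and the `K'`-periodicity of `g`);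
* `corrS4r` — `S₄(r,s)` for one pair `(r,s)` (so that `corrS4 = ∑_r e(ϑsk^{μ₁}r) corrS4r`), and
  **`corrS4r_eq`** — the expansion
  `S₄(r,s) = K'² ∑_{|h₀|,|h₁|<H} â(h₀)â(h₁) ∑_{h₂,h₃<K'} tr(ĝ(h₃)ᴴĝ(h₁+h₃)ĝ(h₂)ᴴĝ(h₀+h₂)) ·
     ∑_n ∑_m e(((h₀+h₁)mn + h₁mr)/K) e(s((n+r)(h₁+h₃) − nh₂)/k^{μ₂−μ₁})`
  (MR (71)–(72) display, matrix form).

## References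
* C. Mauduit, J. Rivat, J. Eur. Math. Soc. 17 (2015), §6.3 (p. 2617), (14)–(15), (71).
  [MauduitRivat2015]
* C. Müllner, Duke Math. J. 166 (2017) = arXiv:1602.03042, §5.4.2 (S₄). [Mullner2017]
-/

noncomputable section

open Finset Complex Matrix
open scoped FourierTransform InnerProductSpace ComplexConjugate Matrix.Norms.Frobenius

namespace Literature.NumberTheory.LFunctions.MauduitRivat

open Literature.NumberTheory.Sieve.RamanujanSum (sum_range_fourierChar_div fourierChar_intCast)
open Literature.NumberTheory.Sieve.Vinogradov (geomBound geomBound_nonneg geomBound_neg)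

/-! ## The Fourier coefficients of the smoothed block indicator -/

/-- The pairs `(j, j') ∈ [1,H]²` with `j − j' = h`. [folklore] -/
def diffFiber (H : ℕ) (h : ℤ) : Finset (ℕ × ℕ) :=
  ((Ioc 0 H) ×ˢ (Ioc 0 H)).filter fun p : ℕ × ℕ => (p.1 : ℤ) - p.2 = h

/-- `#diffFiber H h ≤ H` (the second coordinate determines the pair). [folklore] -/
theorem card_diffFiber_le (H : ℕ) (h : ℤ) : (diffFiber H h).card ≤ H := by
  calc (diffFiber H h).card ≤ (Ioc 0 H).card := by
        refine card_le_card_of_injOn (fun p => p.2) (fun p hp => ?_) (fun p hp p' hp' he => ?_)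
        · rw [diffFiber, mem_coe, mem_filter, mem_product] at hp
          exact hp.1.2
        · rw [diffFiber, mem_coe, mem_filter] at hp hp'
          simp only at he
          have h1 : (p.1 : ℤ) = p'.1 := by rw [← hp'.2] at hp; have := hp.2; rw [he] at this; linarith
          exact Prod.ext (by exact_mod_cast h1) he
    _ = H := by simp

/-- **The Fourier coefficients of the smoothed indicator**:
`â(h) = #{(j,j') : j−j'=h} · (HK)⁻¹ ∑_{y'<L} e(−hy'/K)` (so that `A_u(x) = ∑_h â(h)e(−hu/K')e(hx/K)`).
[cite: MauduitRivat2015, (14) (discrete Fejér analogue of a_h(α,H))] -/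
def ahat (K L H : ℕ) (h : ℤ) : ℂ :=
  ((diffFiber H h).card : ℂ) * ((((H : ℂ) * K)⁻¹) * ∑ y ∈ range L, (𝐞 (-((h : ℝ) * y / K)) : ℂ))

/-- **`‖â(h)‖ ≤ K⁻¹ min(L, 1/(2‖h/K‖))`** (the shape of MR (15): `|a_h(α,H)| ≤ min(α, 1/(π|h|))`,
`α = L/K`). [cite: MauduitRivat2015, (15)] -/
theorem norm_ahat_le {K : ℕ} (hK : 0 < K) (L H : ℕ) (h : ℤ) :
    ‖ahat K L H h‖ ≤ (K : ℝ)⁻¹ * geomBound L ((h : ℝ) / K) := by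
  have hKR : (0 : ℝ) < K := by exact_mod_cast hK
  rcases Nat.eq_zero_or_pos H with rfl | hH
  · have : diffFiber 0 h = ∅ := by simp [diffFiber]
    rw [ahat, this, card_empty, Nat.cast_zero, zero_mul, norm_zero]
    exact mul_nonneg (by positivity) (geomBound_nonneg (Nat.cast_nonneg _) _)
  have hHR : (0 : ℝ) < H := by exact_mod_cast hH
  have hgeom : ‖∑ y ∈ range L, (𝐞 (-((h : ℝ) * y / K)) : ℂ)‖ ≤ geomBound L ((h : ℝ) / K) := by
    have e : ∑ y ∈ range L, (𝐞 (-((h : ℝ) * y / K)) : ℂ) = ∑ y ∈ range L, (𝐞 ((y : ℝ) * (-(h : ℝ) / K)) : ℂ) :=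
      sum_congr rfl fun y _ => by congr 1; ring
    rw [e, ← geomBound_neg, neg_div]
    exact norm_sum_range_fourierChar_le_geomBound _ le_rfl
  rw [ahat, norm_mul, norm_mul, norm_inv, norm_mul, Complex.norm_natCast, Complex.norm_natCast,
    Complex.norm_natCast]
  calc ((diffFiber H h).card : ℝ) * (((H : ℝ) * K)⁻¹ * ‖∑ y ∈ range L, (𝐞 (-((h : ℝ) * y / K)) : ℂ)‖)
      ≤ (H : ℝ) * (((H : ℝ) * K)⁻¹ * geomBound L ((h : ℝ) / K)) := by
        gcongr
        exact_mod_cast card_diffFiber_le H h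
    _ = (K : ℝ)⁻¹ * geomBound L ((h : ℝ) / K) := by field_simp

/-- The difference `j − j'` of a pair in `[1,H]²` lies in `(−H, H)`. [folklore] -/
theorem sub_mem_Ioo_of_mem {H : ℕ} {p : ℕ × ℕ} (hp : p ∈ (Ioc 0 H) ×ˢ (Ioc 0 H)) :
    (p.1 : ℤ) - p.2 ∈ Ioo (-(H : ℤ)) H := by
  rw [mem_product, mem_Ioc, mem_Ioc] at hp
  rw [mem_Ioo]; constructor <;> omega

/-- **The Fourier expansion of the smoothed block indicator**: for `K = K'L ≥ 1` and `u < K'`,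
`A_u(x) = ∑_{h ∈ (−H, H)} â(h) e(−hu/K') e(hx/K)` (as complex numbers).
[cite: MauduitRivat2015, (14)] -/
theorem smoothInd_eq_sum_ahat {K K' L H : ℕ} (hK : K = K' * L) (hKpos : 0 < K) {u : ℕ} (hu : u < K') (x : ℕ) :
    ((smoothInd K L H u x : ℝ) : ℂ) =
      ∑ h ∈ Ioo (-(H : ℤ)) H, ahat K L H h * ((𝐞 (-((h : ℝ) * u / K')) : ℂ) * (𝐞 ((h : ℝ) * x / K) : ℂ)) := by
  have hKR : (K : ℝ) ≠ 0 := by exact_mod_cast hKpos.ne'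
  have hL : 0 < L := by
    rcases Nat.eq_zero_or_pos L with h0 | h0
    · rw [h0, mul_zero] at hK; omega
    · exact h0
  have hK' : 0 < K' := by
    rcases Nat.eq_zero_or_pos K' with h0 | h0
    · rw [h0, zero_mul] at hK; omega
    · exact h0
  have hK'R : (K' : ℝ) ≠ 0 := by exact_mod_cast hK'.ne'
  have hublock : u * L + L ≤ K := by
    calc u * L + L = (u + 1) * L := by ring
      _ ≤ K' * L := Nat.mul_le_mul_right _ hu
      _ = K := hK.symm
  -- the common normal form: a triple sum over `(p, y')`, `p = (j, j')`
  set T : ℕ × ℕ → ℕ → ℂ := fun p y' =>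
    (((H : ℂ) * K)⁻¹) * (𝐞 ((((p.1 : ℤ) - p.2 : ℤ) : ℝ) * ((x : ℝ) / K - (u : ℝ) / K' - (y' : ℝ) / K)) : ℂ)
    with hT
  -- (1) the left-hand side
  have hL1 : ((smoothInd K L H u x : ℝ) : ℂ) = ∑ y' ∈ range L, ∑ p ∈ (Ioc 0 H) ×ˢ (Ioc 0 H), T p y' := by
    rw [smoothInd, Complex.ofReal_sum, sum_Ico_eq_sum_range, show u * L + L - u * L = L by omega]
    refine sum_congr rfl fun y' hy' => ?_
    have hy'L := mem_range.1 hy'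
    rw [fejerPhi_eq_sum, mul_sum, sum_product]
    refine sum_congr rfl fun j _ => ?_
    rw [mul_sum]
    refine sum_congr rfl fun j' _ => ?_
    rw [hT]; dsimp only
    congr 1
    -- the phases agree up to the integer `j − j'`
    have hcast : (((x + (K - (u * L + y')) : ℕ) : ℝ)) = (x : ℝ) + K - (u * L + y' : ℕ) := by
      rw [Nat.cast_add, Nat.cast_sub (by omega)]
      ring
    have e : ((j : ℝ) - j') * (((x + (K - (u * L + y')) : ℕ) : ℝ) / K) =
        ((((j : ℤ) - j' : ℤ) : ℝ)) * ((x : ℝ) / K - (u : ℝ) / K' - (y' : ℝ) / K) + ((((j : ℤ) - j' : ℤ) : ℝ)) := by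
      rw [hcast, hK]; push_cast; field_simp; ring
    rw [e, ← coe_fourierChar_mul, fourierChar_intCast, mul_one]
  -- (2) the right-hand side
  have hR1 : ∑ h ∈ Ioo (-(H : ℤ)) H, ahat K L H h * ((𝐞 (-((h : ℝ) * u / K')) : ℂ) * (𝐞 ((h : ℝ) * x / K) : ℂ)) =
      ∑ p ∈ (Ioc 0 H) ×ˢ (Ioc 0 H), ∑ y' ∈ range L, T p y' := by
    rw [← sum_fiberwise_of_maps_to (s := (Ioc 0 H) ×ˢ (Ioc 0 H)) (t := Ioo (-(H : ℤ)) H)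
      (g := fun p : ℕ × ℕ => (p.1 : ℤ) - p.2) (fun p hp => sub_mem_Ioo_of_mem hp)]
    refine sum_congr rfl fun h _ => ?_
    rw [ahat, ← diffFiber, mul_assoc, mul_assoc, ← nsmul_eq_mul, ← sum_const]
    refine sum_congr rfl fun p hp => ?_
    have hph : (p.1 : ℤ) - p.2 = h := (mem_filter.1 hp).2
    rw [sum_mul, mul_sum]
    refine sum_congr rfl fun y' _ => ?_
    rw [hT]; dsimp only
    rw [hph, coe_fourierChar_mul, coe_fourierChar_mul]
    congr 2
    ring
  rw [hL1, hR1, sum_comm]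

/-! ## The `u`-sums in terms of `ĝ` -/

variable {d : Type*} [Fintype d] [DecidableEq d] {G : Type*} [Group G]

/-- `dftR` is invariant under integer multiples of the period in the frequency. [folklore] -/
theorem dftR_add_int_mul {E : Type*} [NormedAddCommGroup E] [NormedSpace ℂ E] (K : ℕ) (F : ℕ → E)
    (t : ℝ) (m : ℤ) : dftR K F (t + K * m) = dftR K F t := by
  rcases Nat.eq_zero_or_pos K with rfl | hK
  · simp [dftR_apply]
  rw [dftR_apply, dftR_apply]
  congr 1
  refine sum_congr rfl fun u _ => ?_
  congr 1
  have hKR : (K : ℝ) ≠ 0 := by exact_mod_cast hK.ne'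
  have e : -((u : ℝ) * (t + K * m) / K) = -((u : ℝ) * t / K) + ((-(u : ℤ) * m : ℤ) : ℝ) := by
    push_cast; field_simp; ring
  rw [e, ← coe_fourierChar_mul, fourierChar_intCast, mul_one]

/-- The middle-digit matrices are `k^{μ₂−μ₀}`-periodic (`μ₀ ≤ μ₁ ≤ μ₂`). [folklore] -/
theorem gmat_mod (U : G →* unitaryGroup d ℂ) (f : ℕ → G) (k : ℕ) {μ₀ μ₁ μ₂ : ℕ} (h01 : μ₀ ≤ μ₁)
    (h12 : μ₁ ≤ μ₂) (u : ℕ) : gmat U f k μ₀ μ₁ μ₂ (u % k ^ (μ₂ - μ₀)) = gmat U f k μ₀ μ₁ μ₂ u := by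
  rw [gmat, gmat, midFun_mod k h01 h12]

/-- Orthogonality, selecting one residue: for `v < K'`,
`∑_{h<K'} e(h (v − w)/K') = K'` if `v = w mod K'` and `0` otherwise (`w ∈ ℤ`). [folklore] -/
theorem sum_fourierChar_sub_eq {K' : ℕ} (hK' : 0 < K') {v : ℕ} (hv : v < K') (w : ℤ) :
    ∑ h ∈ range K', (𝐞 ((h : ℝ) * (((v : ℤ) - w : ℤ) : ℝ) / K') : ℂ) =
      if (v : ℤ) = w % K' then (K' : ℂ) else 0 := by
  rw [sum_range_fourierChar_div hK'.ne']
  have hiff : (K' : ℤ) ∣ (v : ℤ) - w ↔ (v : ℤ) = w % K' := by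
    rw [← Int.modEq_iff_dvd, Int.ModEq,
      Int.emod_eq_of_lt (a := (v : ℤ)) (b := (K' : ℤ)) (by positivity) (by exact_mod_cast hv)]
    exact eq_comm
  by_cases h : (v : ℤ) = w % K'
  · rw [if_pos (hiff.2 h), if_pos h]
  · rw [if_neg (fun h' => h (hiff.1 h')), if_neg h]

/-- `star e(x) = e(−x)` in `ℂ`. [folklore] -/
theorem star_coe_fourierChar (x : ℝ) : star (𝐞 x : ℂ) = (𝐞 (-x) : ℂ) := conj_coe_fourierChar x

omit [DecidableEq d] in
/-- The adjoint of the discrete Fourier transform of a matrix sequence: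
`ĝ(h)ᴴ = K⁻¹ ∑_{v<K} e(vh/K) G(v)ᴴ`. [folklore] -/
theorem dftR_conjTranspose (K : ℕ) (Gm : ℕ → Matrix d d ℂ) (t : ℝ) :
    (dftR K Gm t)ᴴ = ((K : ℂ)⁻¹) • ∑ v ∈ range K, (𝐞 ((v : ℝ) * t / K) : ℂ) • (Gm v)ᴴ := by
  rw [dftR_apply, conjTranspose_smul, conjTranspose_sum, star_inv₀, star_natCast]
  congr 1
  refine sum_congr rfl fun v _ => ?_
  rw [conjTranspose_smul, star_coe_fourierChar, neg_neg]

/-- **The first `u`-sum** (MR §6.3, the sum over `u₀`; matrix form): for `h₀ ∈ ℤ`, `c ∈ ℕ`,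
`K' = k^{μ₂−μ₀} ≥ 1`, `μ₀ ≤ μ₁ ≤ μ₂`, `G = U ∘ g`, `ĝ = dftR K' G`:
`∑_{u<K'} e(−h₀u/K') G(u+c)ᴴ G(u) = K' ∑_{h₂<K'} e(−ch₂/K') ĝ(h₂)ᴴ ĝ(h₀+h₂)`.
[cite: MauduitRivat2015, §6.3 (p. 2617)] -/
theorem sum_twist_gmat_conj_mul (U : G →* unitaryGroup d ℂ) (f : ℕ → G) {k : ℕ} (hk : 0 < k)
    {μ₀ μ₁ μ₂ : ℕ} (h01 : μ₀ ≤ μ₁) (h12 : μ₁ ≤ μ₂) (h₀ : ℤ) (c : ℕ) :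
    ∑ u ∈ range (k ^ (μ₂ - μ₀)), (𝐞 (-((h₀ : ℝ) * u / (k ^ (μ₂ - μ₀) : ℕ))) : ℂ) •
        ((gmat U f k μ₀ μ₁ μ₂ (u + c))ᴴ * gmat U f k μ₀ μ₁ μ₂ u) =
      ((k ^ (μ₂ - μ₀) : ℕ) : ℂ) • ∑ h₂ ∈ range (k ^ (μ₂ - μ₀)),
        (𝐞 (-((c : ℝ) * h₂ / (k ^ (μ₂ - μ₀) : ℕ))) : ℂ) •
          ((dftR (k ^ (μ₂ - μ₀)) (gmat U f k μ₀ μ₁ μ₂) (h₂ : ℝ))ᴴ *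
            dftR (k ^ (μ₂ - μ₀)) (gmat U f k μ₀ μ₁ μ₂) ((h₀ : ℝ) + h₂)) := by
  have hK' : 0 < k ^ (μ₂ - μ₀) := by positivity
  have hK'C : ((k ^ (μ₂ - μ₀) : ℕ) : ℂ) ≠ 0 := by exact_mod_cast hK'.ne'
  have hK'R : ((k ^ (μ₂ - μ₀) : ℕ) : ℝ) ≠ 0 := by exact_mod_cast hK'.ne'
  -- expand the right-hand side into a triple sum over `(h₂, v, u)`
  have hterm : ∀ h₂ : ℕ, (𝐞 (-((c : ℝ) * h₂ / (k ^ (μ₂ - μ₀) : ℕ))) : ℂ) •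
      ((dftR (k ^ (μ₂ - μ₀)) (gmat U f k μ₀ μ₁ μ₂) (h₂ : ℝ))ᴴ *
        dftR (k ^ (μ₂ - μ₀)) (gmat U f k μ₀ μ₁ μ₂) ((h₀ : ℝ) + h₂)) =
      ∑ v ∈ range (k ^ (μ₂ - μ₀)), ∑ u ∈ range (k ^ (μ₂ - μ₀)),
        ((((k ^ (μ₂ - μ₀) : ℕ) : ℂ)⁻¹ * ((k ^ (μ₂ - μ₀) : ℕ) : ℂ)⁻¹) *
          ((𝐞 ((h₂ : ℝ) * (((v : ℤ) - ((u + c : ℕ) : ℤ) : ℤ) : ℝ) / (k ^ (μ₂ - μ₀) : ℕ)) : ℂ) *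
            (𝐞 (-((h₀ : ℝ) * u / (k ^ (μ₂ - μ₀) : ℕ))) : ℂ))) •
          ((gmat U f k μ₀ μ₁ μ₂ v)ᴴ * gmat U f k μ₀ μ₁ μ₂ u) := by
    intro h₂
    rw [dftR_conjTranspose, dftR_apply, smul_mul_smul_mat, sum_mul_sum, smul_smul, smul_sum]
    refine sum_congr rfl fun v _ => ?_
    rw [smul_sum]
    refine sum_congr rfl fun u _ => ?_
    rw [smul_mul_smul_mat, smul_smul]
    congr 1
    rw [mul_assoc, mul_left_comm]
    congr 1
    rw [coe_fourierChar_mul, coe_fourierChar_mul, coe_fourierChar_mul]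
    congr 2
    push_cast
    field_simp
    ring
  simp_rw [hterm]
  rw [smul_sum]
  symm
  -- reorder to `(v, u, h₂)` and perform the `h₂`-sum
  calc ∑ h₂ ∈ range (k ^ (μ₂ - μ₀)), ((k ^ (μ₂ - μ₀) : ℕ) : ℂ) •
        ∑ v ∈ range (k ^ (μ₂ - μ₀)), ∑ u ∈ range (k ^ (μ₂ - μ₀)),
          ((((k ^ (μ₂ - μ₀) : ℕ) : ℂ)⁻¹ * ((k ^ (μ₂ - μ₀) : ℕ) : ℂ)⁻¹) *
            ((𝐞 ((h₂ : ℝ) * (((v : ℤ) - ((u + c : ℕ) : ℤ) : ℤ) : ℝ) / (k ^ (μ₂ - μ₀) : ℕ)) : ℂ) *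
              (𝐞 (-((h₀ : ℝ) * u / (k ^ (μ₂ - μ₀) : ℕ))) : ℂ))) •
            ((gmat U f k μ₀ μ₁ μ₂ v)ᴴ * gmat U f k μ₀ μ₁ μ₂ u)
      = ∑ v ∈ range (k ^ (μ₂ - μ₀)), ∑ u ∈ range (k ^ (μ₂ - μ₀)),
          ((((k ^ (μ₂ - μ₀) : ℕ) : ℂ)⁻¹ *
            ((∑ h₂ ∈ range (k ^ (μ₂ - μ₀)),
                (𝐞 ((h₂ : ℝ) * (((v : ℤ) - ((u + c : ℕ) : ℤ) : ℤ) : ℝ) / (k ^ (μ₂ - μ₀) : ℕ)) : ℂ)) *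
              (𝐞 (-((h₀ : ℝ) * u / (k ^ (μ₂ - μ₀) : ℕ))) : ℂ)))) •
            ((gmat U f k μ₀ μ₁ μ₂ v)ᴴ * gmat U f k μ₀ μ₁ μ₂ u) := by
        simp only [smul_sum]
        rw [sum_comm]
        refine sum_congr rfl fun v _ => ?_
        rw [sum_comm]
        refine sum_congr rfl fun u _ => ?_
        simp only [smul_smul]
        rw [← sum_smul]
        congr 1
        rw [sum_mul, mul_sum]
        refine sum_congr rfl fun h₂ _ => ?_
        field_simp
    _ = ∑ u ∈ range (k ^ (μ₂ - μ₀)), (𝐞 (-((h₀ : ℝ) * u / (k ^ (μ₂ - μ₀) : ℕ))) : ℂ) •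
          ((gmat U f k μ₀ μ₁ μ₂ ((u + c) % k ^ (μ₂ - μ₀)))ᴴ * gmat U f k μ₀ μ₁ μ₂ u) := by
        rw [sum_comm]
        refine sum_congr rfl fun u _ => ?_
        have horth : ∀ v ∈ range (k ^ (μ₂ - μ₀)),
            (∑ h₂ ∈ range (k ^ (μ₂ - μ₀)),
              (𝐞 ((h₂ : ℝ) * (((v : ℤ) - ((u + c : ℕ) : ℤ) : ℤ) : ℝ) / (k ^ (μ₂ - μ₀) : ℕ)) : ℂ)) =
              if v = (u + c) % k ^ (μ₂ - μ₀) then ((k ^ (μ₂ - μ₀) : ℕ) : ℂ) else 0 := by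
          intro v hv
          rw [sum_fourierChar_sub_eq hK' (mem_range.1 hv)]
          have hiff : (v : ℤ) = ((u + c : ℕ) : ℤ) % (k ^ (μ₂ - μ₀) : ℕ) ↔ v = (u + c) % k ^ (μ₂ - μ₀) := by
            rw [← Int.natCast_mod]; exact Int.natCast_inj
          by_cases h : v = (u + c) % k ^ (μ₂ - μ₀)
          · rw [if_pos (hiff.2 h), if_pos h]
          · rw [if_neg (fun h' => h (hiff.1 h')), if_neg h]
        rw [sum_congr rfl fun v hv => by rw [horth v hv]]
        simp only [mul_ite, mul_zero, ite_mul, zero_mul, ite_smul, zero_smul, sum_ite_eq', mem_range,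
          Nat.mod_lt _ hK', if_true]
        congr 1
        field_simp
    _ = _ := by
        refine sum_congr rfl fun u _ => ?_
        rw [gmat_mod U f k h01 h12]

/-- Orthogonality with the opposite orientation: for `w < K'`,
`∑_{h<K'} e(h (v − w)/K') = K'` if `w = v mod K'` and `0` otherwise (`v ∈ ℤ`). [folklore] -/
theorem sum_fourierChar_sub_eq' {K' : ℕ} (hK' : 0 < K') (v : ℤ) {w : ℕ} (hw : w < K') :
    ∑ h ∈ range K', (𝐞 ((h : ℝ) * ((v - (w : ℤ) : ℤ) : ℝ) / K') : ℂ) =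
      if (w : ℤ) = v % K' then (K' : ℂ) else 0 := by
  rw [sum_range_fourierChar_div hK'.ne']
  have hiff : (K' : ℤ) ∣ v - (w : ℤ) ↔ (w : ℤ) = v % K' := by
    rw [dvd_sub_comm, ← Int.modEq_iff_dvd, Int.ModEq,
      Int.emod_eq_of_lt (a := (w : ℤ)) (b := (K' : ℤ)) (by positivity) (by exact_mod_cast hw)]
    exact eq_comm
  by_cases h : (w : ℤ) = v % K'
  · rw [if_pos (hiff.2 h), if_pos h]
  · rw [if_neg (fun h' => h (hiff.1 h')), if_neg h]

/-- **The second `u`-sum** (the sum over `u₁`; matrix form):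
`∑_{u<K'} e(−h₁u/K') G(u)ᴴ G(u+c) = K' ∑_{h₃<K'} e(c(h₁+h₃)/K') ĝ(h₃)ᴴ ĝ(h₁+h₃)`.
[cite: MauduitRivat2015, §6.3 (p. 2617)] -/
theorem sum_twist_gmat_conj_mul' (U : G →* unitaryGroup d ℂ) (f : ℕ → G) {k : ℕ} (hk : 0 < k)
    {μ₀ μ₁ μ₂ : ℕ} (h01 : μ₀ ≤ μ₁) (h12 : μ₁ ≤ μ₂) (h₁ : ℤ) (c : ℕ) :
    ∑ u ∈ range (k ^ (μ₂ - μ₀)), (𝐞 (-((h₁ : ℝ) * u / (k ^ (μ₂ - μ₀) : ℕ))) : ℂ) •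
        ((gmat U f k μ₀ μ₁ μ₂ u)ᴴ * gmat U f k μ₀ μ₁ μ₂ (u + c)) =
      ((k ^ (μ₂ - μ₀) : ℕ) : ℂ) • ∑ h₃ ∈ range (k ^ (μ₂ - μ₀)),
        (𝐞 ((c : ℝ) * ((h₁ : ℝ) + h₃) / (k ^ (μ₂ - μ₀) : ℕ)) : ℂ) •
          ((dftR (k ^ (μ₂ - μ₀)) (gmat U f k μ₀ μ₁ μ₂) (h₃ : ℝ))ᴴ *
            dftR (k ^ (μ₂ - μ₀)) (gmat U f k μ₀ μ₁ μ₂) ((h₁ : ℝ) + h₃)) := by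
  have hK' : 0 < k ^ (μ₂ - μ₀) := by positivity
  have hK'C : ((k ^ (μ₂ - μ₀) : ℕ) : ℂ) ≠ 0 := by exact_mod_cast hK'.ne'
  have hK'R : ((k ^ (μ₂ - μ₀) : ℕ) : ℝ) ≠ 0 := by exact_mod_cast hK'.ne'
  -- expand the right-hand side into a triple sum over `(h₃, v, w)` (`v` from `ĝ(h₃)ᴴ`, `w` from `ĝ(h₁+h₃)`)
  have hterm : ∀ h₃ : ℕ, (𝐞 ((c : ℝ) * ((h₁ : ℝ) + h₃) / (k ^ (μ₂ - μ₀) : ℕ)) : ℂ) •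
      ((dftR (k ^ (μ₂ - μ₀)) (gmat U f k μ₀ μ₁ μ₂) (h₃ : ℝ))ᴴ *
        dftR (k ^ (μ₂ - μ₀)) (gmat U f k μ₀ μ₁ μ₂) ((h₁ : ℝ) + h₃)) =
      ∑ v ∈ range (k ^ (μ₂ - μ₀)), ∑ w ∈ range (k ^ (μ₂ - μ₀)),
        ((((k ^ (μ₂ - μ₀) : ℕ) : ℂ)⁻¹ * ((k ^ (μ₂ - μ₀) : ℕ) : ℂ)⁻¹) *
          ((𝐞 ((h₃ : ℝ) * ((((v + c : ℕ) : ℤ) - (w : ℤ) : ℤ) : ℝ) / (k ^ (μ₂ - μ₀) : ℕ)) : ℂ) *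
            (𝐞 (-((h₁ : ℝ) * ((w : ℝ) - c) / (k ^ (μ₂ - μ₀) : ℕ))) : ℂ))) •
          ((gmat U f k μ₀ μ₁ μ₂ v)ᴴ * gmat U f k μ₀ μ₁ μ₂ w) := by
    intro h₃
    rw [dftR_conjTranspose, dftR_apply, smul_mul_smul_mat, sum_mul_sum, smul_smul, smul_sum]
    refine sum_congr rfl fun v _ => ?_
    rw [smul_sum]
    refine sum_congr rfl fun w _ => ?_
    rw [smul_mul_smul_mat, smul_smul]
    congr 1
    rw [mul_assoc, mul_left_comm]
    congr 1
    rw [coe_fourierChar_mul, coe_fourierChar_mul, coe_fourierChar_mul]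
    congr 2
    push_cast
    field_simp
    ring
  simp_rw [hterm]
  rw [smul_sum]
  symm
  calc ∑ h₃ ∈ range (k ^ (μ₂ - μ₀)), ((k ^ (μ₂ - μ₀) : ℕ) : ℂ) •
        ∑ v ∈ range (k ^ (μ₂ - μ₀)), ∑ w ∈ range (k ^ (μ₂ - μ₀)),
          ((((k ^ (μ₂ - μ₀) : ℕ) : ℂ)⁻¹ * ((k ^ (μ₂ - μ₀) : ℕ) : ℂ)⁻¹) *
            ((𝐞 ((h₃ : ℝ) * ((((v + c : ℕ) : ℤ) - (w : ℤ) : ℤ) : ℝ) / (k ^ (μ₂ - μ₀) : ℕ)) : ℂ) *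
              (𝐞 (-((h₁ : ℝ) * ((w : ℝ) - c) / (k ^ (μ₂ - μ₀) : ℕ))) : ℂ))) •
            ((gmat U f k μ₀ μ₁ μ₂ v)ᴴ * gmat U f k μ₀ μ₁ μ₂ w)
      = ∑ v ∈ range (k ^ (μ₂ - μ₀)), ∑ w ∈ range (k ^ (μ₂ - μ₀)),
          ((((k ^ (μ₂ - μ₀) : ℕ) : ℂ)⁻¹ *
            ((∑ h₃ ∈ range (k ^ (μ₂ - μ₀)),
                (𝐞 ((h₃ : ℝ) * ((((v + c : ℕ) : ℤ) - (w : ℤ) : ℤ) : ℝ) / (k ^ (μ₂ - μ₀) : ℕ)) : ℂ)) *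
              (𝐞 (-((h₁ : ℝ) * ((w : ℝ) - c) / (k ^ (μ₂ - μ₀) : ℕ))) : ℂ)))) •
            ((gmat U f k μ₀ μ₁ μ₂ v)ᴴ * gmat U f k μ₀ μ₁ μ₂ w) := by
        simp only [smul_sum]
        rw [sum_comm]
        refine sum_congr rfl fun v _ => ?_
        rw [sum_comm]
        refine sum_congr rfl fun w _ => ?_
        simp only [smul_smul]
        rw [← sum_smul]
        congr 1
        rw [sum_mul, mul_sum]
        refine sum_congr rfl fun h₃ _ => ?_
        field_simp
    _ = ∑ v ∈ range (k ^ (μ₂ - μ₀)),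
          (𝐞 (-((h₁ : ℝ) * ((((v + c) % k ^ (μ₂ - μ₀) : ℕ) : ℝ) - c) / (k ^ (μ₂ - μ₀) : ℕ))) : ℂ) •
            ((gmat U f k μ₀ μ₁ μ₂ v)ᴴ * gmat U f k μ₀ μ₁ μ₂ ((v + c) % k ^ (μ₂ - μ₀))) := by
        refine sum_congr rfl fun v _ => ?_
        have horth : ∀ w ∈ range (k ^ (μ₂ - μ₀)),
            (∑ h₃ ∈ range (k ^ (μ₂ - μ₀)),
              (𝐞 ((h₃ : ℝ) * ((((v + c : ℕ) : ℤ) - (w : ℤ) : ℤ) : ℝ) / (k ^ (μ₂ - μ₀) : ℕ)) : ℂ)) =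
              if w = (v + c) % k ^ (μ₂ - μ₀) then ((k ^ (μ₂ - μ₀) : ℕ) : ℂ) else 0 := by
          intro w hw
          rw [sum_fourierChar_sub_eq' hK' _ (mem_range.1 hw)]
          have hiff : (w : ℤ) = ((v + c : ℕ) : ℤ) % (k ^ (μ₂ - μ₀) : ℕ) ↔ w = (v + c) % k ^ (μ₂ - μ₀) := by
            rw [← Int.natCast_mod]; exact Int.natCast_inj
          by_cases h : w = (v + c) % k ^ (μ₂ - μ₀)
          · rw [if_pos (hiff.2 h), if_pos h]
          · rw [if_neg (fun h' => h (hiff.1 h')), if_neg h]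
        rw [sum_congr rfl fun w hw => by rw [horth w hw]]
        simp only [mul_ite, mul_zero, ite_mul, zero_mul, ite_smul, zero_smul, sum_ite_eq', mem_range,
          Nat.mod_lt _ hK', if_true]
        congr 1
        field_simp
    _ = _ := by
        refine sum_congr rfl fun v _ => ?_
        rw [gmat_mod U f k h01 h12]
        congr 1
        -- the phases agree up to the integer `h₁ ⌊(v+c)/K'⌋`
        obtain ⟨q, hq⟩ : ∃ q : ℕ, (v + c) / k ^ (μ₂ - μ₀) = q := ⟨_, rfl⟩
        have hdm := Nat.div_add_mod (v + c) (k ^ (μ₂ - μ₀))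
        rw [hq] at hdm
        have hv : (((v + c) % k ^ (μ₂ - μ₀) : ℕ) : ℝ) = (v : ℝ) + c - (k ^ (μ₂ - μ₀) : ℕ) * (q : ℝ) := by
          have := congrArg (fun n : ℕ => (n : ℝ)) hdm
          push_cast at this ⊢
          linarith
        have e : -((h₁ : ℝ) * ((((v + c) % k ^ (μ₂ - μ₀) : ℕ) : ℝ) - c) / (k ^ (μ₂ - μ₀) : ℕ)) =
            -((h₁ : ℝ) * v / (k ^ (μ₂ - μ₀) : ℕ)) + ((h₁ * (q : ℤ) : ℤ) : ℝ) := by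
          rw [hv]; push_cast; field_simp; ring
        rw [e, ← coe_fourierChar_mul, fourierChar_intCast, mul_one]

/-! ## The double sum over the prescribed digits -/

/-- `wordTrace` as a trace of middle-digit matrices:
`tr U(g(u₁+c₁)g(u₀+c₀)⁻¹g(u₀)g(u₁)⁻¹) = tr(G(u₁)ᴴG(u₁+c₁) · G(u₀+c₀)ᴴG(u₀))`, `c₀ = s̃n`, `c₁ = s̃(n+r)`
(cyclicity of the trace). [cite: Mullner2017, §5.4.2] -/
theorem wordTrace_eq_trace (U : G →* unitaryGroup d ℂ) (f : ℕ → G) (k μ₀ μ₁ μ₂ s n r u₀ u₁ : ℕ) :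
    wordTrace U f k μ₀ μ₁ μ₂ s n r u₀ u₁ =
      trace (((gmat U f k μ₀ μ₁ μ₂ u₁)ᴴ * gmat U f k μ₀ μ₁ μ₂ (u₁ + s * k ^ (μ₁ - μ₀) * (n + r))) *
        ((gmat U f k μ₀ μ₁ μ₂ (u₀ + s * k ^ (μ₁ - μ₀) * n))ᴴ * gmat U f k μ₀ μ₁ μ₂ u₀)) := by
  rw [wordTrace, map_mul, map_mul, map_mul, map_inv, map_inv, Submonoid.coe_mul, Submonoid.coe_mul,
    Submonoid.coe_mul, coe_inv_unitary, coe_inv_unitary]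
  simp only [gmat]
  -- `tr(A Bᴴ C Dᴴ) = tr(Dᴴ A · Bᴴ C)`
  rw [show ∀ A B C D : Matrix d d ℂ, A * Bᴴ * C * Dᴴ = A * (Bᴴ * C) * Dᴴ from fun A B C D => by
    simp only [Matrix.mul_assoc], trace_mul_cycle, ← Matrix.mul_assoc]

/-- **The double sum over `u₀, u₁`** (MR §6.3): with `c₀ = s̃n`, `c₁ = s̃(n+r)`, `s̃ = sk^{μ₁−μ₀}`,
`K' = k^{μ₂−μ₀}`,
`∑_{u₀,u₁<K'} e(−h₀u₀/K') e(−h₁u₁/K') tr(word) = K'² ∑_{h₂,h₃<K'} e(c₁(h₁+h₃)/K') e(−c₀h₂/K') tr(ĝ(h₃)ᴴĝ(h₁+h₃)ĝ(h₂)ᴴĝ(h₀+h₂))`.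
[cite: MauduitRivat2015, §6.3 (p. 2617)] [cite: Mullner2017, §5.4.2 (S₄)] -/
theorem sum_sum_twist_wordTrace_eq (U : G →* unitaryGroup d ℂ) (f : ℕ → G) {k : ℕ} (hk : 0 < k)
    {μ₀ μ₁ μ₂ : ℕ} (h01 : μ₀ ≤ μ₁) (h12 : μ₁ ≤ μ₂) (s n r : ℕ) (h₀ h₁ : ℤ) :
    ∑ u₀ ∈ range (k ^ (μ₂ - μ₀)), ∑ u₁ ∈ range (k ^ (μ₂ - μ₀)),
        ((𝐞 (-((h₀ : ℝ) * u₀ / (k ^ (μ₂ - μ₀) : ℕ))) : ℂ) * (𝐞 (-((h₁ : ℝ) * u₁ / (k ^ (μ₂ - μ₀) : ℕ))) : ℂ)) *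
          wordTrace U f k μ₀ μ₁ μ₂ s n r u₀ u₁ =
      (((k ^ (μ₂ - μ₀) : ℕ) : ℂ) * ((k ^ (μ₂ - μ₀) : ℕ) : ℂ)) *
        ∑ h₂ ∈ range (k ^ (μ₂ - μ₀)), ∑ h₃ ∈ range (k ^ (μ₂ - μ₀)),
          ((𝐞 (((s * k ^ (μ₁ - μ₀) * (n + r) : ℕ) : ℝ) * ((h₁ : ℝ) + h₃) / (k ^ (μ₂ - μ₀) : ℕ)) : ℂ) *
            (𝐞 (-(((s * k ^ (μ₁ - μ₀) * n : ℕ) : ℝ) * h₂ / (k ^ (μ₂ - μ₀) : ℕ))) : ℂ)) *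
            trace ((dftR (k ^ (μ₂ - μ₀)) (gmat U f k μ₀ μ₁ μ₂) (h₃ : ℝ))ᴴ *
              dftR (k ^ (μ₂ - μ₀)) (gmat U f k μ₀ μ₁ μ₂) ((h₁ : ℝ) + h₃) *
              ((dftR (k ^ (μ₂ - μ₀)) (gmat U f k μ₀ μ₁ μ₂) (h₂ : ℝ))ᴴ *
                dftR (k ^ (μ₂ - μ₀)) (gmat U f k μ₀ μ₁ μ₂) ((h₀ : ℝ) + h₂))) := by
  -- the two one-variable sums
  have hU1 := sum_twist_gmat_conj_mul' U f hk h01 h12 h₁ (s * k ^ (μ₁ - μ₀) * (n + r))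
  have hU0 := sum_twist_gmat_conj_mul U f hk h01 h12 h₀ (s * k ^ (μ₁ - μ₀) * n)
  -- the left side as the trace of a product of the two sums
  calc ∑ u₀ ∈ range (k ^ (μ₂ - μ₀)), ∑ u₁ ∈ range (k ^ (μ₂ - μ₀)),
        ((𝐞 (-((h₀ : ℝ) * u₀ / (k ^ (μ₂ - μ₀) : ℕ))) : ℂ) * (𝐞 (-((h₁ : ℝ) * u₁ / (k ^ (μ₂ - μ₀) : ℕ))) : ℂ)) *
          wordTrace U f k μ₀ μ₁ μ₂ s n r u₀ u₁
      = trace ((∑ u₁ ∈ range (k ^ (μ₂ - μ₀)), (𝐞 (-((h₁ : ℝ) * u₁ / (k ^ (μ₂ - μ₀) : ℕ))) : ℂ) •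
            ((gmat U f k μ₀ μ₁ μ₂ u₁)ᴴ * gmat U f k μ₀ μ₁ μ₂ (u₁ + s * k ^ (μ₁ - μ₀) * (n + r)))) *
          (∑ u₀ ∈ range (k ^ (μ₂ - μ₀)), (𝐞 (-((h₀ : ℝ) * u₀ / (k ^ (μ₂ - μ₀) : ℕ))) : ℂ) •
            ((gmat U f k μ₀ μ₁ μ₂ (u₀ + s * k ^ (μ₁ - μ₀) * n))ᴴ * gmat U f k μ₀ μ₁ μ₂ u₀))) := by
        rw [sum_mul_sum, trace_sum, sum_comm]
        refine sum_congr rfl fun u₀ _ => ?_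
        rw [trace_sum]
        refine sum_congr rfl fun u₁ _ => ?_
        rw [smul_mul_smul_mat, trace_smul, smul_eq_mul, wordTrace_eq_trace, mul_comm (𝐞 _ : ℂ)]
    _ = _ := by
        rw [hU1, hU0, smul_mul_smul_mat, trace_smul, smul_eq_mul, sum_mul_sum, trace_sum]
        congr 1
        rw [sum_comm]
        refine sum_congr rfl fun h₂ _ => ?_
        rw [trace_sum]
        refine sum_congr rfl fun h₃ _ => ?_
        rw [smul_mul_smul_mat, trace_smul, smul_eq_mul, Matrix.mul_assoc]

/-! ## Reordering nested sums -/

section SumComm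

variable {M : Type*} [AddCommMonoid M] {α β γ δ ε : Type*}

/-- Move the first of three nested sums to the end. [folklore] -/
theorem sum_rotate3 (A : Finset α) (B : Finset β) (C : Finset γ) (f : α → β → γ → M) :
    ∑ a ∈ A, ∑ b ∈ B, ∑ c ∈ C, f a b c = ∑ b ∈ B, ∑ c ∈ C, ∑ a ∈ A, f a b c := by
  rw [sum_comm]
  exact sum_congr rfl fun b _ => sum_comm

/-- Move the first of five nested sums to the end. [folklore] -/
theorem sum_rotate5 (A : Finset α) (B : Finset β) (C : Finset γ) (D : Finset δ) (E : Finset ε)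
    (f : α → β → γ → δ → ε → M) :
    ∑ a ∈ A, ∑ b ∈ B, ∑ c ∈ C, ∑ d ∈ D, ∑ e ∈ E, f a b c d e =
      ∑ b ∈ B, ∑ c ∈ C, ∑ d ∈ D, ∑ e ∈ E, ∑ a ∈ A, f a b c d e := by
  rw [sum_comm]
  refine sum_congr rfl fun b _ => ?_
  rw [sum_comm]
  refine sum_congr rfl fun c _ => ?_
  exact sum_rotate3 A D E fun a d e => f a b c d e

end SumComm

/-! ## `S₄(r, s)` and its Fourier expansion -/

/-- `S₄(r,s)` for one pair `(r,s)` (no phase `e(ϑ s k^{μ₁} r)`):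
`∑_n ∑_{m, m+sk^{μ₁}<M₁} ∑_{u₀,u₁<k^{μ₂−μ₀}} A_{u₀}(mn) A_{u₁}(mn+mr) tr U(word)`.
[cite: MauduitRivat2015, (64) (S₄(r,s))] -/
def corrS4r (U : G →* unitaryGroup d ℂ) (f : ℕ → G) (k μ₀ μ₁ μ₂ Hs : ℕ) (M₀ M₁ N₀ N₁ r s : ℕ) : ℂ :=
  ∑ n ∈ Ico N₀ N₁, ∑ m ∈ (Ico M₀ M₁).filter (fun m => m + s * k ^ μ₁ < M₁),
    ∑ u₀ ∈ range (k ^ (μ₂ - μ₀)), ∑ u₁ ∈ range (k ^ (μ₂ - μ₀)),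
      ((smoothInd (k ^ μ₂) (k ^ μ₀) Hs u₀ (m * n) * smoothInd (k ^ μ₂) (k ^ μ₀) Hs u₁ (m * n + m * r) : ℝ) : ℂ) *
        wordTrace U f k μ₀ μ₁ μ₂ s n r u₀ u₁

/-- `S₄(s) = ∑_{1≤r<R} e(ϑ s k^{μ₁} r) S₄(r,s)`. [folklore] -/
theorem corrS4_eq_sum_corrS4r (U : G →* unitaryGroup d ℂ) (f : ℕ → G) (k μ₀ μ₁ μ₂ Hs : ℕ) (ϑ : ℝ)
    (M₀ M₁ N₀ N₁ R s : ℕ) :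
    corrS4 U f k μ₀ μ₁ μ₂ Hs ϑ M₀ M₁ N₀ N₁ R s =
      ∑ r ∈ Ico 1 R, (𝐞 (ϑ * (s * ((k ^ μ₁ : ℕ) : ℝ)) * r) : ℂ) * corrS4r U f k μ₀ μ₁ μ₂ Hs M₀ M₁ N₀ N₁ r s := by
  rw [corrS4]
  refine sum_congr rfl fun r _ => ?_
  rw [corrS4r, mul_sum]
  exact sum_congr rfl fun n _ => by rw [mul_sum]

/-- **Mauduit–Rivat §6.3 for unitary matrices: the Fourier expansion of `S₄(r,s)`** (`μ₀ ≤ μ₁ ≤ μ₂`,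
`k ≥ 1`; `K = k^{μ₂}`, `L = k^{μ₀}`, `K' = k^{μ₂−μ₀}`, `s̃ = s k^{μ₁−μ₀}`):
`S₄(r,s) = K'² ∑_{|h₀|,|h₁|<H} â(h₀)â(h₁) ∑_{h₂,h₃<K'} tr(ĝ(h₃)ᴴĝ(h₁+h₃)ĝ(h₂)ᴴĝ(h₀+h₂))
   · ∑_n ∑_m e(((h₀+h₁)mn + h₁mr)/K) e(s̃(n+r)(h₁+h₃)/K') e(−s̃nh₂/K')`.
[cite: MauduitRivat2015, §6.3 (the display for S₄(r,s), p. 2617)] [cite: Mullner2017, §5.4.2 (S₄)] -/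
theorem corrS4r_eq (U : G →* unitaryGroup d ℂ) (f : ℕ → G) {k : ℕ} (hk : 0 < k) {μ₀ μ₁ μ₂ : ℕ}
    (h01 : μ₀ ≤ μ₁) (h12 : μ₁ ≤ μ₂) (Hs M₀ M₁ N₀ N₁ r s : ℕ) :
    corrS4r U f k μ₀ μ₁ μ₂ Hs M₀ M₁ N₀ N₁ r s =
      (((k ^ (μ₂ - μ₀) : ℕ) : ℂ) * ((k ^ (μ₂ - μ₀) : ℕ) : ℂ)) *
        ∑ h₀ ∈ Ioo (-(Hs : ℤ)) Hs, ∑ h₁ ∈ Ioo (-(Hs : ℤ)) Hs,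
          ahat (k ^ μ₂) (k ^ μ₀) Hs h₀ * ahat (k ^ μ₂) (k ^ μ₀) Hs h₁ *
            ∑ h₂ ∈ range (k ^ (μ₂ - μ₀)), ∑ h₃ ∈ range (k ^ (μ₂ - μ₀)),
              trace ((dftR (k ^ (μ₂ - μ₀)) (gmat U f k μ₀ μ₁ μ₂) (h₃ : ℝ))ᴴ *
                dftR (k ^ (μ₂ - μ₀)) (gmat U f k μ₀ μ₁ μ₂) ((h₁ : ℝ) + h₃) *
                ((dftR (k ^ (μ₂ - μ₀)) (gmat U f k μ₀ μ₁ μ₂) (h₂ : ℝ))ᴴ *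
                  dftR (k ^ (μ₂ - μ₀)) (gmat U f k μ₀ μ₁ μ₂) ((h₀ : ℝ) + h₂))) *
              ∑ n ∈ Ico N₀ N₁, ∑ m ∈ (Ico M₀ M₁).filter (fun m => m + s * k ^ μ₁ < M₁),
                (𝐞 ((((h₀ : ℝ) + h₁) * m * n + (h₁ : ℝ) * m * r) / (k ^ μ₂ : ℕ)) : ℂ) *
                  ((𝐞 (((s * k ^ (μ₁ - μ₀) * (n + r) : ℕ) : ℝ) * ((h₁ : ℝ) + h₃) / (k ^ (μ₂ - μ₀) : ℕ)) : ℂ) *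
                    (𝐞 (-(((s * k ^ (μ₁ - μ₀) * n : ℕ) : ℝ) * h₂ / (k ^ (μ₂ - μ₀) : ℕ))) : ℂ)) := by
  have h02 : μ₀ ≤ μ₂ := h01.trans h12
  have hK : k ^ μ₂ = k ^ (μ₂ - μ₀) * k ^ μ₀ := by rw [← pow_add, Nat.sub_add_cancel h02]
  have hKpos : 0 < k ^ μ₂ := by positivity
  -- Step 1: the inner double sum for fixed `(n, m)`
  have hinner : ∀ n m : ℕ,
      ∑ u₀ ∈ range (k ^ (μ₂ - μ₀)), ∑ u₁ ∈ range (k ^ (μ₂ - μ₀)),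
        ((smoothInd (k ^ μ₂) (k ^ μ₀) Hs u₀ (m * n) * smoothInd (k ^ μ₂) (k ^ μ₀) Hs u₁ (m * n + m * r) : ℝ) : ℂ) *
          wordTrace U f k μ₀ μ₁ μ₂ s n r u₀ u₁ =
      ∑ h₀ ∈ Ioo (-(Hs : ℤ)) Hs, ∑ h₁ ∈ Ioo (-(Hs : ℤ)) Hs,
        (ahat (k ^ μ₂) (k ^ μ₀) Hs h₀ * ahat (k ^ μ₂) (k ^ μ₀) Hs h₁ *
          ((𝐞 ((h₀ : ℝ) * (m * n : ℕ) / (k ^ μ₂ : ℕ)) : ℂ) * (𝐞 ((h₁ : ℝ) * (m * n + m * r : ℕ) / (k ^ μ₂ : ℕ)) : ℂ))) *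
          ∑ u₀ ∈ range (k ^ (μ₂ - μ₀)), ∑ u₁ ∈ range (k ^ (μ₂ - μ₀)),
            ((𝐞 (-((h₀ : ℝ) * u₀ / (k ^ (μ₂ - μ₀) : ℕ))) : ℂ) * (𝐞 (-((h₁ : ℝ) * u₁ / (k ^ (μ₂ - μ₀) : ℕ))) : ℂ)) *
              wordTrace U f k μ₀ μ₁ μ₂ s n r u₀ u₁ := by
    intro n m
    -- expand both indicators
    have hexp : ∀ u₀ ∈ range (k ^ (μ₂ - μ₀)), ∀ u₁ ∈ range (k ^ (μ₂ - μ₀)),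
        ((smoothInd (k ^ μ₂) (k ^ μ₀) Hs u₀ (m * n) * smoothInd (k ^ μ₂) (k ^ μ₀) Hs u₁ (m * n + m * r) : ℝ) : ℂ) *
          wordTrace U f k μ₀ μ₁ μ₂ s n r u₀ u₁ =
        ∑ h₀ ∈ Ioo (-(Hs : ℤ)) Hs, ∑ h₁ ∈ Ioo (-(Hs : ℤ)) Hs,
          (ahat (k ^ μ₂) (k ^ μ₀) Hs h₀ * ahat (k ^ μ₂) (k ^ μ₀) Hs h₁ *
            ((𝐞 ((h₀ : ℝ) * (m * n : ℕ) / (k ^ μ₂ : ℕ)) : ℂ) * (𝐞 ((h₁ : ℝ) * (m * n + m * r : ℕ) / (k ^ μ₂ : ℕ)) : ℂ))) *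
            (((𝐞 (-((h₀ : ℝ) * u₀ / (k ^ (μ₂ - μ₀) : ℕ))) : ℂ) * (𝐞 (-((h₁ : ℝ) * u₁ / (k ^ (μ₂ - μ₀) : ℕ))) : ℂ)) *
              wordTrace U f k μ₀ μ₁ μ₂ s n r u₀ u₁) := by
      intro u₀ hu₀ u₁ hu₁
      rw [Complex.ofReal_mul, smoothInd_eq_sum_ahat hK hKpos (mem_range.1 hu₀),
        smoothInd_eq_sum_ahat hK hKpos (mem_range.1 hu₁), sum_mul_sum, sum_mul]
      refine sum_congr rfl fun h₀ _ => ?_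
      rw [sum_mul]
      refine sum_congr rfl fun h₁ _ => ?_
      push_cast
      ring
    rw [sum_congr rfl fun u₀ hu₀ => sum_congr rfl fun u₁ hu₁ => hexp u₀ hu₀ u₁ hu₁]
    -- reorder `(u₀, u₁, h₀, h₁) → (h₀, h₁, u₀, u₁)` and factor the `u`-independent part
    refine Eq.trans (sum_congr rfl fun u₀ _ => sum_comm) ?_
    rw [sum_comm]
    refine sum_congr rfl fun h₀ _ => ?_
    refine Eq.trans (sum_congr rfl fun u₀ _ => sum_comm) ?_
    rw [sum_comm]
    refine sum_congr rfl fun h₁ _ => ?_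
    rw [mul_sum]
    refine sum_congr rfl fun u₀ _ => ?_
    rw [mul_sum]
  -- Step 2: insert the evaluation of the `u`-sums and reorder
  rw [corrS4r]
  rw [sum_congr rfl fun n _ => sum_congr rfl fun m _ => hinner n m]
  simp_rw [sum_sum_twist_wordTrace_eq U f hk h01 h12]
  -- both sides as the six-fold sum of one summand
  simp only [mul_sum]
  -- move `n` and `m` inside
  refine Eq.trans (sum_congr rfl fun n _ => sum_rotate5 _ _ _ _ _ _) ?_
  refine Eq.trans (sum_rotate5 _ _ _ _ _ _) ?_
  refine sum_congr rfl fun h₀ _ => sum_congr rfl fun h₁ _ => sum_congr rfl fun h₂ _ =>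
    sum_congr rfl fun h₃ _ => sum_congr rfl fun n _ => sum_congr rfl fun m _ => ?_
  -- the summands agree
  rw [coe_fourierChar_mul]
  have e : (h₀ : ℝ) * ((m * n : ℕ) : ℝ) / (k ^ μ₂ : ℕ) + (h₁ : ℝ) * ((m * n + m * r : ℕ) : ℝ) / (k ^ μ₂ : ℕ) =
      (((h₀ : ℝ) + h₁) * m * n + (h₁ : ℝ) * m * r) / (k ^ μ₂ : ℕ) := by
    push_cast; ring
  rw [e]
  ring

end Literature.NumberTheory.LFunctions.MauduitRivat
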